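import Summits.CriticalPhenomena.PercolationContinuityZ3.Theorems.FK.Transplant.KNFreeSlabGates
import HarnessLib

/-!
# FRONTIER TRANSPLANT, binder 2 (TP_FK) research line R-TP — T4-SLAB (P3): the relay's SUB-PLATES behind the window
# (placed slab copies in the collar, on the side where the far set extends, off the gate residues; R-TP-NOTE-g184 §3)

Support file (`--supports stmt-CriticalPhenomena-4575`, helper) of the FRONTIER TRANSPLANT sub-cell (`fk-continuity/transplant/`,
seat `prim-bschramm-fkt-p1`); builds on p205010 (kernel theorem, internal audit signed; external expert review pending).
0 definitions · 0 named facts · 0 sorries · standard axioms. File 13/18 of the bytes-first package (R60 (3)(β)) of the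
UNFUNDED memo row `T4-SLAB [g122, R60]` (re-described R62 (E)); proposable only on a coordinator ruling.
Registered R63 (cell INBOX l.4709, 2026-08-23); registry row T4s; lead label T4s-13 (fkt-lead L22, l.4677).

HONEST FRAMING (page 1, cell rule). The transplant's theorem of record `ufsc0_of_freeBoundaryHypothesis_r3` (p248245) is
CONDITIONAL on FH AND on TP_FK = `KNFreeTargetHittable d q p`, both OPEN at the same `p` for `q > 1` near `p_c(q)` (⇔ GRC Conj.
(5.103) via K1; barrier note `Literature.Barriers.CriticalPhenomena.SamePFreeBoundaryCriteria`, FBN-01, cited first); the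
transplant is a typed reduction, not a proof of FK continuity. THIS FILE is lattice combinatorics for the slab Step IV: behind the
central window of a contact on the face `(i, σ)` of the level box it places `n′` pairwise disjoint copies of the slab box
`S(L, N_P)` (thin direction `i` = the collar layers `1 … 2L+1`, long directions `c, e`), lined up in direction `c` on the side
`s` of the cube centre, every transverse coordinate range avoiding the gate residue `g₀ (mod Pbig)`, `Pbig = 2N_P + 3`; the
relay `u` (layer 1) and the lane exits `u + s k Π e_c` (layer 1) / `… - σ·2L·e_i` (layer `2L+1`) lie in the copy. Nothing about either binder.

References: G. Grimmett, *The Random-Cluster Model*, Springer 2006, §5.7 (slabs placed inside boxes) [Grimmett2006];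
G. Kozma, S. Nitzan, arXiv:2401.12397 (2024), §4 Lemma 10 Step IV (pp. 19–21) [KozmaNitzan2024].
-/

noncomputable section

namespace Summit.CriticalPhenomena.PercolationContinuityZ3.Theorems.FK

open scoped Classical
open Literature.Probability.Percolation Literature.Probability.LatticeModels SimpleGraph
open Literature.Probability.Percolation.KozmaNitzan Literature.Barriers.CriticalPhenomena

variable {d : ℕ}

/-- **Coordinates of a placed slab copy**: with the long slab axes sent to `c ≠ e`, a point lies in
`σ_π S(L,N) + ctr` iff it is within `N` of `ctr` in directions `c, e` and within `L` in every other direction.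
[cite: Grimmett2006, §5.7 (the slabs S(L,n) and their images under automorphisms)] -/
theorem mem_image_signedPerm_add_iff_of_long (hd : 2 ≤ d) {L N : ℕ} {c e : Fin d} (π : Equiv.Perm (Fin d))
    (hπc : π ⟨d - 2, by omega⟩ = c) (hπe : π ⟨d - 1, by omega⟩ = e) (ctr x : Site d) :
    x ∈ (fkSlab d L N).image (fun q => Site.signedPerm π 1 q + ctr) ↔
      (|x c - ctr c| ≤ N ∧ |x e - ctr e| ≤ N ∧ ∀ b, b ≠ c → b ≠ e → |x b - ctr b| ≤ L) := by
  have hce : c ≠ e := by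
    rw [← hπc, ← hπe]; intro h; have := congrArg Fin.val (π.injective h); simp at this; omega
  -- half-width per ambient coordinate
  have hwj : ∀ j : Fin d, (fkSlabHalfWidth d L N j : ℤ) = if (π j = c ∨ π j = e) then (N : ℤ) else (L : ℤ) := by
    intro j
    by_cases hj : d ≤ j.val + 2
    · have : j = ⟨d - 2, by omega⟩ ∨ j = ⟨d - 1, by omega⟩ := by
        rcases Nat.lt_or_ge j.val (d - 1) with h | h
        · left; ext; simp; omega
        · right; ext; simp; omega
      rcases this with h | h
      · rw [h, hπc]; have h' : d ≤ (d - 2) + 2 := by omega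
        simp [fkSlabHalfWidth, h']
      · rw [h, hπe]; have h' : d ≤ (d - 1) + 2 := by omega
        simp [fkSlabHalfWidth, h']
    · have hj1 : π j ≠ c := by
        intro h; rw [← hπc] at h; have := congrArg Fin.val (π.injective h); simp at this; omega
      have hj2 : π j ≠ e := by
        intro h; rw [← hπe] at h; have := congrArg Fin.val (π.injective h); simp at this; omega
      simp [fkSlabHalfWidth, hj, hj1, hj2]
  rw [mem_image_signedPerm_add_iff]
  constructor
  · intro h
    have key : ∀ b, |x b - ctr b| ≤ (if (b = c ∨ b = e) then (N : ℤ) else (L : ℤ)) := by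
      intro b
      have := h (π.symm b); rw [hwj, Equiv.apply_symm_apply] at this
      rw [abs_le]; exact ⟨by linarith [this.1], this.2⟩
    refine ⟨by simpa using key c, by simpa [hce.symm] using key e, fun b hbc hbe => ?_⟩
    simpa [hbc, hbe] using key b
  · rintro ⟨hc, he, hb⟩ j
    rw [hwj j]
    by_cases hj : π j = c ∨ π j = e
    · rw [if_pos hj]
      rcases hj with h | h <;> rw [h]
      · rw [abs_le] at hc; exact ⟨by linarith [hc.1], hc.2⟩
      · rw [abs_le] at he; exact ⟨by linarith [he.1], he.2⟩
    · rw [if_neg hj]; rw [not_or] at hj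
      have := hb (π j) hj.1 hj.2; rw [abs_le] at this; exact ⟨by linarith [this.1], this.2⟩

/-- **A window of length `2N_P + 1` starting one past the residue misses it**: if `Pbig = 2N_P + 3`,
`base ≡ g₀ + 1 (mod Pbig)` and `base ≤ t ≤ base + 2N_P` then `t ≢ g₀ (mod Pbig)`. [folklore] -/
theorem not_modEq_of_window {N_P Pbig : ℕ} (hP : Pbig = 2 * N_P + 3) {base g₀ t : ℤ}
    (hbase : base ≡ g₀ + 1 [ZMOD Pbig]) (ht : base ≤ t ∧ t ≤ base + 2 * N_P) : ¬ t ≡ g₀ [ZMOD Pbig] := by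
  intro hmod
  have h1 : t + 1 ≡ base [ZMOD Pbig] := by
    have := (hmod.add_right 1).trans hbase.symm; exact this
  rw [Int.modEq_iff_dvd] at h1
  obtain ⟨k, hk⟩ := h1
  have hP' : (Pbig : ℤ) = 2 * N_P + 3 := by rw [hP]; push_cast; ring
  have hN0 : (0 : ℤ) ≤ N_P := Nat.cast_nonneg N_P
  rcases le_or_gt 0 k with hk0 | hk0
  · have : (0 : ℤ) ≤ (Pbig : ℤ) * k := mul_nonneg (by linarith) hk0
    linarith
  · have : (Pbig : ℤ) * k ≤ Pbig * (-1) := mul_le_mul_of_nonneg_left (by omega) (by linarith)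
    linarith

/-- **Centres of the sub-plates.** Behind the window of the contact `(i, σ, y)` (cube centre `v`), on the side `s` in
direction `c ≠ i`, there are centres `ctr 0, …, ctr (n′-1)` with: layer `L+1` in direction `i`; `c`-ranges
`[ctr_c - N_P, ctr_c + N_P]` inside `(v_c, v_c + s·M₀]`, pairwise more than `2N_P` apart, starting one past the
residue `g₀ (mod Pbig)`; every other transverse coordinate within `Pbig` of `v` with its `N_P`-window starting one
past the residue. [folklore] -/
theorem exists_subplate_centres (i c : Fin d) (hci : c ≠ i) (σ s : ℤ) (hs : s = 1 ∨ s = -1) (y v : Site d)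
    (L N_P Pbig n' M₀ : ℕ) (hP : Pbig = 2 * N_P + 3) (hM₀ : ((n' : ℤ) + 2) * Pbig ≤ M₀) (g₀ : ℤ) :
    ∃ ctr : ℕ → Site d, ∀ j < n',
      ctr j i = y i - σ * ((L : ℤ) + 1) ∧
      ((N_P : ℤ) + 1 ≤ s * (ctr j c - v c) ∧ s * (ctr j c - v c) + N_P ≤ M₀) ∧
      ctr j c - N_P ≡ g₀ + 1 [ZMOD Pbig] ∧
      (∀ j' < n', j' ≠ j → 2 * (N_P : ℤ) < |ctr j c - ctr j' c|) ∧
      (∀ b, b ≠ i → b ≠ c → |ctr j b - v b| ≤ Pbig ∧ ctr j b - N_P ≡ g₀ + 1 [ZMOD Pbig]) := by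
  have hP1 : 1 ≤ Pbig := by omega
  have hP' : (Pbig : ℤ) = 2 * N_P + 3 := by rw [hP]; push_cast; ring
  have hN0 : (0 : ℤ) ≤ N_P := Nat.cast_nonneg N_P
  -- transverse offsets off `{i, c}`
  have hoff : ∀ b : Fin d, ∃ x : ℤ, v b - N_P ≤ x ∧ x ≤ v b - N_P + Pbig - 1 ∧ x ≡ g₀ + 1 [ZMOD Pbig] :=
    fun b => exists_modEq_mem Pbig hP1 (v b - N_P) (g₀ + 1)
  choose off hoff1 hoff2 hoffm using hoff
  -- the base of the `c`-progression, by sign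
  obtain ⟨bc, hbc1, hbc2, hbcm⟩ : ∃ bc : ℤ, (N_P : ℤ) + 1 ≤ s * (bc + N_P - v c) ∧
      s * (bc + N_P - v c) ≤ (N_P : ℤ) + Pbig + 1 ∧ bc ≡ g₀ + 1 [ZMOD Pbig] := by
    rcases hs with hs1 | hs1
    · obtain ⟨x, hx1, hx2, hxm⟩ := exists_modEq_mem Pbig hP1 (v c + 1) (g₀ + 1)
      exact ⟨x, by rw [hs1]; linarith, by rw [hs1]; linarith, hxm⟩
    · obtain ⟨x, hx1, hx2, hxm⟩ := exists_modEq_mem Pbig hP1 (v c - 2 * N_P - Pbig) (g₀ + 1)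
      exact ⟨x, by rw [hs1]; linarith, by rw [hs1]; linarith, hxm⟩
  have hmul0 : ∀ j : ℕ, s * (j : ℤ) * Pbig ≡ 0 [ZMOD Pbig] := fun j =>
    Int.modEq_zero_iff_dvd.2 (Dvd.intro_left (s * (j : ℤ)) rfl)
  refine ⟨fun j b => if b = i then y i - σ * ((L : ℤ) + 1) else if b = c then bc + N_P + s * j * Pbig else off b + N_P,
    fun j hj => ⟨by simp, ?_, ?_, fun j' hj' hjj' => ?_, fun b hbi hbc => ?_⟩⟩
  · simp only [if_neg hci, if_true]
    have hj0 : (0 : ℤ) ≤ j := Nat.cast_nonneg j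
    have hjn : (j : ℤ) + 1 ≤ n' := by exact_mod_cast hj
    have hjP : (0 : ℤ) ≤ (j : ℤ) * Pbig := by positivity
    have h2 : ((j : ℤ) + 2) * Pbig ≤ M₀ := le_trans (mul_le_mul_of_nonneg_right (by linarith) (by positivity)) hM₀
    rcases hs with hs1 | hs1
    · rw [hs1] at hbc1 hbc2 ⊢; constructor <;> nlinarith
    · rw [hs1] at hbc1 hbc2 ⊢; constructor <;> nlinarith
  · simp only [if_neg hci, if_true]
    have : bc + N_P + s * j * Pbig - N_P = bc + s * j * Pbig := by ring
    rw [this]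
    simpa using hbcm.add (hmul0 j)
  · simp only [if_neg hci, if_true]
    have hdiff : bc + ↑N_P + s * ↑j * ↑Pbig - (bc + ↑N_P + s * ↑j' * ↑Pbig) = s * (((j : ℤ) - j') * Pbig) := by ring
    rw [hdiff, abs_mul, abs_mul]
    have hsabs : |s| = 1 := by rcases hs with h | h <;> rw [h] <;> norm_num
    rw [hsabs, one_mul, abs_of_nonneg (show (0 : ℤ) ≤ Pbig by positivity)]
    have hjj : (1 : ℤ) ≤ |(j : ℤ) - j'| := by
      rcases lt_or_gt_of_ne hjj' with h | h
      · have h' : (j' : ℤ) + 1 ≤ j := by exact_mod_cast h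
        rw [abs_of_nonneg (by linarith)]; linarith
      · have h' : (j : ℤ) + 1 ≤ j' := by exact_mod_cast h
        rw [abs_of_neg (by linarith)]; linarith
    have := mul_le_mul_of_nonneg_right hjj (show (0 : ℤ) ≤ Pbig by positivity)
    linarith
  · simp only [if_neg hbi, if_neg hbc]
    refine ⟨?_, ?_⟩
    · rw [abs_le]; constructor <;> linarith [hoff1 b, hoff2 b]
    · have h : off b + ↑N_P - ↑N_P = off b := by ring
      rw [h]; exact hoffm b

/-- **Coordinates of a sub-plate's points**: for a centre `ctr` as in `exists_subplate_centres` (layer `L+1` below the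
face `(i, σ)`, transverse coordinates within `M₀` of the cube centre `v` and with `N_P`-windows one past the residue),
every point of the placed copy has `i`-depth in `[1, 2L+1]`, is transversally deeper than `T`, and has no transverse
coordinate `≡ g₀ (mod Pbig)`. [folklore] -/
theorem subplate_coords (hd : 2 ≤ d) {L N_P Pbig T : ℕ} (hP : Pbig = 2 * N_P + 3) (hLN : L ≤ N_P)
    (Lo Hi : Site d) (i c e : Fin d) (hci : c ≠ i) (hei : e ≠ i) (π : Equiv.Perm (Fin d))
    (hπc : π ⟨d - 2, by omega⟩ = c) (hπe : π ⟨d - 1, by omega⟩ = e)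
    (σ : ℤ) (yi : ℤ) (hface : (σ = 1 ∧ yi = Hi i) ∨ (σ = -1 ∧ yi = Lo i)) (v ctr : Site d) (M₀ M : ℕ) (g₀ : ℤ)
    (hctri : ctr i = yi - σ * ((L : ℤ) + 1)) (hctrb : ∀ b, b ≠ i → |ctr b - v b| ≤ M₀)
    (hres : ∀ b, b ≠ i → ctr b - N_P ≡ g₀ + 1 [ZMOD Pbig])
    (hvb : ∀ b, b ≠ i → Lo b + M + 1 ≤ v b ∧ v b ≤ Hi b - M - 1) (hM : M₀ + N_P + T ≤ M)
    {x : Site d} (hx : x ∈ (fkSlab d L N_P).image (fun q => Site.signedPerm π 1 q + ctr)) :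
    ((σ = 1 → 1 ≤ Hi i - x i ∧ Hi i - x i ≤ 2 * L + 1) ∧ (σ = -1 → 1 ≤ x i - Lo i ∧ x i - Lo i ≤ 2 * L + 1)) ∧
    (∀ b, b ≠ i → Lo b + T + 1 ≤ x b ∧ x b ≤ Hi b - T - 1 ∧ |x b - v b| ≤ (M₀ : ℤ) + N_P) ∧
    (∀ b, b ≠ i → ¬ x b ≡ g₀ [ZMOD Pbig]) := by
  rw [mem_image_signedPerm_add_iff_of_long hd π hπc hπe] at hx
  obtain ⟨hxc, hxe, hxb⟩ := hx
  have hLN' : (L : ℤ) ≤ N_P := by exact_mod_cast hLN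
  have hM' : (M₀ : ℤ) + N_P + T ≤ M := by exact_mod_cast hM
  have hxb' : ∀ b, b ≠ i → |x b - ctr b| ≤ N_P := by
    intro b hb
    by_cases hbc : b = c
    · rw [hbc]; exact hxc
    · by_cases hbe : b = e
      · rw [hbe]; exact hxe
      · exact (hxb b hbc hbe).trans hLN'
  have hxi : |x i - ctr i| ≤ L := hxb i hci.symm hei.symm
  rw [hctri, abs_le] at hxi
  refine ⟨⟨fun hσ => ?_, fun hσ => ?_⟩, fun b hb => ?_, fun b hb => ?_⟩
  · obtain ⟨-, hy⟩ | ⟨h, -⟩ := hface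
    · rw [hσ, hy] at hxi; constructor <;> linarith [hxi.1, hxi.2]
    · rw [hσ] at h; norm_num at h
  · obtain ⟨h, -⟩ | ⟨-, hy⟩ := hface
    · rw [hσ] at h; norm_num at h
    · rw [hσ, hy] at hxi; constructor <;> linarith [hxi.1, hxi.2]
  · have h1 := hxb' b hb; have h2 := hctrb b hb; have h3 := hvb b hb
    rw [abs_le] at h1 h2
    refine ⟨by linarith, by linarith, ?_⟩
    rw [abs_le]; constructor <;> linarith
  · have h1 := hxb' b hb; rw [abs_le] at h1
    exact not_modEq_of_window hP (hres b hb) ⟨by linarith, by linarith⟩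

/-- **The relay and the lane exits lie in the sub-plate**: `u = ctr[i ↦ yi - σ]` (layer 1), the outer exits
`u[c ↦ ctr_c + s k Pl]` and the inner exits (the same on layer `2L+1`), for `k·Pl ≤ N_P` (`Pl` the lane spacing). [folklore] -/
theorem relay_exits_mem (hd : 2 ≤ d) {L N_P : ℕ} (i c e : Fin d) (hci : c ≠ i) (hei : e ≠ i)
    (π : Equiv.Perm (Fin d)) (hπc : π ⟨d - 2, by omega⟩ = c) (hπe : π ⟨d - 1, by omega⟩ = e)
    (σ : ℤ) (hσ : σ = 1 ∨ σ = -1) (yi : ℤ) (ctr : Site d) (hctri : ctr i = yi - σ * ((L : ℤ) + 1))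
    (s : ℤ) (hs : s = 1 ∨ s = -1) (Pl : ℕ) (k : ℕ) (hk : k * Pl ≤ N_P) :
    Function.update ctr i (yi - σ) ∈ (fkSlab d L N_P).image (fun q => Site.signedPerm π 1 q + ctr) ∧
    Function.update (Function.update ctr i (yi - σ)) c (ctr c + s * k * Pl) ∈
      (fkSlab d L N_P).image (fun q => Site.signedPerm π 1 q + ctr) ∧
    Function.update (Function.update ctr i (yi - σ * (2 * (L : ℤ) + 1))) c (ctr c + s * k * Pl) ∈
      (fkSlab d L N_P).image (fun q => Site.signedPerm π 1 q + ctr) := by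
  have hce : c ≠ e := by
    rw [← hπc, ← hπe]; intro h; have := congrArg Fin.val (π.injective h); simp at this; omega
  have hk' : (k : ℤ) * Pl ≤ N_P := by exact_mod_cast hk
  have hkP0 : (0 : ℤ) ≤ (k : ℤ) * Pl := by positivity
  have hsk : |s * k * Pl| ≤ (N_P : ℤ) := by
    rcases hs with h | h <;> rw [h]
    · rw [one_mul, abs_of_nonneg hkP0]; exact hk'
    · rw [show (-1 : ℤ) * k * Pl = -(k * Pl) by ring, abs_neg, abs_of_nonneg hkP0]; exact hk'
  have hN0 : (0 : ℤ) ≤ N_P := Nat.cast_nonneg N_P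
  have hL0 : (0 : ℤ) ≤ L := Nat.cast_nonneg L
  refine ⟨?_, ?_, ?_⟩ <;> rw [mem_image_signedPerm_add_iff_of_long hd π hπc hπe]
  · refine ⟨?_, ?_, fun b hbc hbe => ?_⟩
    · rw [Function.update_of_ne hci, sub_self, abs_zero]; exact hN0
    · rw [Function.update_of_ne hei, sub_self, abs_zero]; exact hN0
    · by_cases hbi : b = i
      · rw [hbi, Function.update_self, hctri]; rcases hσ with h | h <;> rw [h, abs_le] <;> constructor <;> linarith
      · rw [Function.update_of_ne hbi, sub_self, abs_zero]; exact hL0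
  · refine ⟨?_, ?_, fun b hbc hbe => ?_⟩
    · rw [Function.update_self, add_sub_cancel_left]; exact hsk
    · rw [Function.update_of_ne hce.symm, Function.update_of_ne hei, sub_self, abs_zero]; exact hN0
    · rw [Function.update_of_ne hbc]
      by_cases hbi : b = i
      · rw [hbi, Function.update_self, hctri]; rcases hσ with h | h <;> rw [h, abs_le] <;> constructor <;> linarith
      · rw [Function.update_of_ne hbi, sub_self, abs_zero]; exact hL0
  · refine ⟨?_, ?_, fun b hbc hbe => ?_⟩
    · rw [Function.update_self, add_sub_cancel_left]; exact hsk
    · rw [Function.update_of_ne hce.symm, Function.update_of_ne hei, sub_self, abs_zero]; exact hN0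
    · rw [Function.update_of_ne hbc]
      by_cases hbi : b = i
      · rw [hbi, Function.update_self, hctri]; rcases hσ with h | h <;> rw [h, abs_le] <;> constructor <;> linarith
      · rw [Function.update_of_ne hbi, sub_self, abs_zero]; exact hL0

/-- Sub-plates whose `c`-centres are more than `2N_P` apart are disjoint. [folklore] -/
theorem disjoint_subplates (hd : 2 ≤ d) {L N_P : ℕ} (c e : Fin d) (π : Equiv.Perm (Fin d))
    (hπc : π ⟨d - 2, by omega⟩ = c) (hπe : π ⟨d - 1, by omega⟩ = e) (ctr ctr' : Site d)
    (hsep : 2 * (N_P : ℤ) < |ctr c - ctr' c|) :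
    Disjoint ((fkSlab d L N_P).image (fun q => Site.signedPerm π 1 q + ctr))
      ((fkSlab d L N_P).image (fun q => Site.signedPerm π 1 q + ctr')) := by
  rw [Finset.disjoint_left]
  intro x hx hx'
  rw [mem_image_signedPerm_add_iff_of_long hd π hπc hπe] at hx hx'
  have h1 := hx.1; have h2 := hx'.1
  rw [abs_le] at h1 h2
  have : |ctr c - ctr' c| ≤ 2 * (N_P : ℤ) := abs_le.2 ⟨by linarith, by linarith⟩
  linarith

/-- **The relay lies on Kozma–Nitzan's face `U(P)`** of the window of `(i, σ, y)`: a layer-1 point whose transverse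
coordinates are within `M` of the window centre. [cite: KozmaNitzan2024, §4 p. 21 (U(P))] -/
theorem update_mem_uface {Lo Hi : Site d} {M : ℕ} {i : Fin d} {σ : ℤ} {y : Site d} (ctr : Site d)
    (hctrb : ∀ b, b ≠ i → |ctr b - wctr Lo Hi M i y b| ≤ M) :
    Function.update ctr i (y i - σ) ∈ uface Lo Hi M i σ y := by
  rw [mem_uface_iff, mem_plaq_iff]
  constructor
  · simp
  · intro k hk
    simp only [Pi.add_apply, Pi.smul_apply, smul_eq_mul, Function.update_of_ne hk, unitVec_apply_of_ne hk, mul_zero,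
      add_zero]
    exact hctrb k hk

end Summit.CriticalPhenomena.PercolationContinuityZ3.Theorems.FK

end
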